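import Summits.NavierStokesRegularity.NavierStokesRegularity.Theorems.SoloSalvageWu2026Construct
import Summits.NavierStokesRegularity.NavierStokesRegularity.Theorems.SoloSalvageWu2026ConstructWeakBd
import Summits.NavierStokesRegularity.NavierStokesRegularity.Theorems.SoloSalvageWu2026ConstructLimit
import Summits.NavierStokesRegularity.NavierStokesRegularity.Theorems.SoloSalvageWu2026ConstructCompactV
import Summits.NavierStokesRegularity.NavierStokesRegularity.Theorems.SoloSalvageWu2026ConstructSobolevE
import HarnessLib

/-!
# C177 `Wu2026` — `Step_construct` from two local gradient bounds and the pressure compactness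
# (composition record; cell `pub/ns-inputs`, seat `ns-in-wu-con`; route business of
# `GaldiLiouvilleGate`, item stmt-NavierStokesRegularity-0897)

Composition of the seat's kernel objects for the binder `Literature.Claims.NS.Wu2026.Step_construct`
(§3.2–§3.4 of W. Wu, arXiv:2608.22471v1: existence of the Euler blow-down tangent): of the five
printed sub-steps of `step_construct_of_pieces` (`…Construct`), (C) the limit equations and (D) the
inherited weak bounds are PROVED (`step_construct_pieceC`, `step_construct_pieceD`), (A) velocity
compactness is reduced to the uniform local `L¹` gradient bound (G1)
(`step_construct_pieceA_of_localGradBound`, Rellich–Kondrachov) and (E) the Sobolev bounds to the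
uniform local `L^{9/5}` gradient bound at good scales (G2) (`step_construct_pieceE_of_localGradBound`,
weak compactness in a weighted `L^{9/5}`). Hence

  `step_construct_of_gradBounds : (G1) → (G2) → (B) → Step_construct`,

where (G1), (G2) are both instances of ONE classical estimate not yet in the tree — the local
div–curl / Calderón–Zygmund bound `‖∇u‖_p ≤ C_p(‖div u‖_p + ‖curl u‖_p)`, `u ∈ C_c^∞(ℝ³; ℝ³)`,
`1 < p ≤ 9/5` (Stein 1970, Ch. III §1.3; in print (3.21)–(3.25), (3.33)–(3.34)) applied to `χV_j`
— and (B) is the pressure compactness (3.45).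

Theorems only, standard axioms, no `sorry`.

WHAT THIS IS NOT: not a proof of `Step_construct`; not a claim about NS regularity or blow-up; item
0897 is a route crux (GaldiLiouvilleGate), not the summit; not a claim about any author beyond the
typed locator.
-/

set_option linter.dupNamespace false

noncomputable section

open MeasureTheory Set Filter Topology Metric
open scoped ENNReal NNReal Topology RealInnerProductSpace

namespace Summit.NavierStokesRegularity.NavierStokesRegularity.Theorems.Wu2026Salvage

open Literature.Analysis.FluidPDE Literature.Analysis.FunctionSpaces Literature.Claims.NS.Wu2026

/-- **`Step_construct` from (G1), (G2) and (B).** (G1): at all scales, `sup_j ∫_{B(c,|c|/3)} |∇V_j| < ∞`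
for `c ≠ 0`; (G2): at good scales, `sup_j ∫_{B(c,r)} |∇V_j|^{9/5} < ∞` for `1 + r < |c|`; (B): the
pressure compactness (3.45) — hypothesis `hB` of `step_construct_of_pieces`. [cite: Wu2026, §3.2–§3.4 p.9–19] -/
theorem step_construct_of_gradBounds
    (hG1 : ∀ ν : ℝ, 0 < ν → ∀ (v : E3 → E3) (p : E3 → ℝ), IsWuFlow ν v p →
      MemWeakLp v ((9 : ℝ≥0∞) / 2) volume →
      (∀ q : ℝ, 1 < q → q < 9 / 2 → ∃ C : ℝ, ∀ R : ℝ, 0 < R →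
        IntegrableOn (fun x => ‖v x‖ ^ q) (annulus R) ∧
        (∫ x in annulus R, ‖v x‖ ^ q) ^ (1 / q) ≤ C * R ^ (-(2 : ℝ) / 3 + 3 / q)) →
      ∀ n : ℕ → ℕ, ∀ c : E3, c ≠ 0 → ∃ C : ℝ, ∀ j : ℕ,
        ∫ y in ball c (‖c‖ / 3), ‖fderiv ℝ (blowDown ((2 : ℝ) ^ n j) v) y‖ ≤ C)
    (hG2 : ∀ ν : ℝ, 0 < ν → ∀ (v : E3 → E3) (p : E3 → ℝ), IsWuFlow ν v p →
      MemWeakLp v ((9 : ℝ≥0∞) / 2) volume →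
      (∀ q : ℝ, 1 < q → q < 9 / 2 → ∃ C : ℝ, ∀ R : ℝ, 0 < R →
        IntegrableOn (fun x => ‖v x‖ ^ q) (annulus R) ∧
        (∫ x in annulus R, ‖v x‖ ^ q) ^ (1 / q) ≤ C * R ^ (-(2 : ℝ) / 3 + 3 / q)) →
      ∀ n : ℕ → ℕ, Tendsto n atTop atTop →
        (∀ m : ℕ, ∃ B : ℝ, ∀ j : ℕ, max 1 m ≤ j → dyMass v (n j + m) ≤ B) →
      ∀ c : E3, ∀ r : ℝ, 0 < r → 1 + r < ‖c‖ → ∃ C : ℝ, ∀ j : ℕ,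
        ∫ y in ball c r, ‖fderiv ℝ (blowDown ((2 : ℝ) ^ n j) v) y‖ ^ ((9 : ℝ) / 5) ≤ C)
    (hB : ∀ ν : ℝ, 0 < ν → ∀ (v : E3 → E3) (p : E3 → ℝ), IsWuFlow ν v p →
      MemWeakLp v ((9 : ℝ≥0∞) / 2) volume →
      (∀ q : ℝ, 1 < q → q < 9 / 2 → ∃ C : ℝ, ∀ R : ℝ, 0 < R →
        IntegrableOn (fun x => ‖v x‖ ^ q) (annulus R) ∧
        (∫ x in annulus R, ‖v x‖ ^ q) ^ (1 / q) ≤ C * R ^ (-(2 : ℝ) / 3 + 3 / q)) →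
      ∀ c : ℝ, MemWeakLp (fun x => p x - c) ((9 : ℝ≥0∞) / 4) volume →
        MemWeakLp (bern v (fun x => p x - c)) ((9 : ℝ≥0∞) / 4) volume →
      ∀ n : ℕ → ℕ, Tendsto n atTop atTop →
      ∀ V : E3 → E3, AEStronglyMeasurable V volume →
        (∀ K : Set E3, IsCompact K → K ⊆ punctured →
          IntegrableOn (fun y => ‖V y‖ ^ (4 : ℝ)) K) →
        (∀ K : Set E3, IsCompact K → K ⊆ punctured →
          Tendsto (fun j => ∫ y in K, ‖blowDown ((2 : ℝ) ^ n j) v y - V y‖ ^ (4 : ℝ))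
            atTop (𝓝 0)) →
      ∃ σ : ℕ → ℕ, StrictMono σ ∧ ∃ P : E3 → ℝ, AEStronglyMeasurable P volume ∧
        (∀ K : Set E3, IsCompact K → K ⊆ punctured →
          IntegrableOn (fun y => |P y| ^ ((4 : ℝ) / 2)) K) ∧
        (∀ K : Set E3, IsCompact K → K ⊆ punctured →
          Tendsto (fun j => ∫ y in K,
            |blowDownP ((2 : ℝ) ^ n (σ j)) (fun x => p x - c) y - P y| ^ ((4 : ℝ) / 2))
            atTop (𝓝 0))) :
    Step_construct :=
  step_construct_of_pieces (step_construct_pieceA_of_localGradBound hG1) hB step_construct_pieceC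
    step_construct_pieceD (step_construct_pieceE_of_localGradBound hG2)

end Summit.NavierStokesRegularity.NavierStokesRegularity.Theorems.Wu2026Salvage

end

-- WHAT THIS IS NOT: not a claim about NS regularity or blow-up; not a claim about any author beyond the typed locator.
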